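import Mathlib
import Literature.NumberTheory.Transcendental.SemialgebraicMaps

/-!
# `IsometryMove`, line `bruhat-inversion-chain`: the inversion move data

Stub `stub_inversionMove` of the crux `IsometryMove` (stmt-KontsevichZagierPeriods-3471, route
HyperbolicBloch). In the upper half-space `ℝ³` (coordinates `p 0 = x`, `p 1 = y`, `p 2 = t`) the unit
inversion composed with the mirror `y ↦ -y`,
`J(p) = (p₀, −p₁, p₂) / (p₀² + p₁² + p₂²)` — the Poincaré extension of the Möbius map `w ↦ 1/w` — supplies on
every `ℚ`-semialgebraic `σ ⊆ {t > 0}` the four data consumed by the one-move transport lemma of the line: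

* `J` is a `ℚ`-semialgebraic map on `σ` (its coordinates are quotients of rational polynomials with the
  denominator `|p|² > 0` on `σ`);
* `J` is injective on `σ` (it is an involution of `ℝ³ ∖ {0}`);
* `J` maps `σ` into `{t > 0}` (`(J p)₂ = t / |p|²`);
* `J` has at `p ≠ 0` the Fréchet derivative of matrix `M(p) = (δᵢⱼ sᵢ |p|² − 2 sᵢ pᵢ pⱼ) / |p|⁴`
  (`s = (1, −1, 1)`), whose determinant is `+|p|⁻⁶` (rank-one update: `det(|p|² I − 2 p pᵀ) = −|p|⁶`,
  times `det diag(1, −1, 1) = −1`), whence the Jacobian identity `t⁻³ = ((J p)₂)⁻³ · |det M(p)|`.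

References: R. Benedetti, C. Petronio, *Lectures on Hyperbolic Geometry* (1992), A.3.5 (proof of (2):
inversion in a sphere), A.4.2; M. Kontsevich, D. Zagier, *Periods* (2001), §1.2 rule (2); J. Bochnak,
M. Coste, M.-F. Roy, *Real Algebraic Geometry* (1998), §2.2.
-/

noncomputable section

open Set MeasureTheory MvPolynomial
open Literature.NumberTheory.Transcendental Literature.ModelTheory.ExponentialFields

namespace Summit.KontsevichZagierPeriods.HyperbolicBloch.IsometryMove

/-- On the open upper half-space the squared norm `p₀² + p₁² + p₂²` is positive. [folklore] -/
theorem inversion_normSq_pos {p : Fin 3 → ℝ} (hp : 0 < p 2) : 0 < p 0 ^ 2 + p 1 ^ 2 + p 2 ^ 2 := by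
  positivity

/-- The coordinates of `J` are quotients of polynomials with rational coefficients whose denominator
`|p|²` does not vanish on `σ ⊆ {t > 0}`; hence `J` is a `ℚ`-semialgebraic map on `σ`.
[cite: BochnakCosteRoy1998, §2.2] -/
theorem inversion_isSemialgebraicMapOn (J : (Fin 3 → ℝ) → (Fin 3 → ℝ))
    (hJ : ∀ p, J p = ![p 0 / (p 0 ^ 2 + p 1 ^ 2 + p 2 ^ 2), -p 1 / (p 0 ^ 2 + p 1 ^ 2 + p 2 ^ 2),
      p 2 / (p 0 ^ 2 + p 1 ^ 2 + p 2 ^ 2)])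
    {σ : Set (Fin 3 → ℝ)} (hσ : IsSemialgebraic ℚ σ) (hpos : σ ⊆ {p | 0 < p 2}) :
    IsSemialgebraicMapOn ℚ σ J := by
  set q : MvPolynomial (Fin 3) ℚ := X 0 ^ 2 + X 1 ^ 2 + X 2 ^ 2 with hq
  have hq0 : ∀ p ∈ σ, aeval p q ≠ 0 := fun p hp => by
    have h := inversion_normSq_pos (hpos hp)
    simp only [hq, map_add, map_pow, aeval_X]
    exact h.ne'
  have hqe : ∀ p : Fin 3 → ℝ, aeval p q = p 0 ^ 2 + p 1 ^ 2 + p 2 ^ 2 := fun p => by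
    simp [hq]
  refine IsSemialgebraicMapOn.of_forall hσ fun j => ?_
  fin_cases j
  · exact (isSemialgebraicFunOn_aeval_div_aeval hσ (X 0) q hq0).congr fun p _ => by
      simp [hJ, hqe]
  · exact (isSemialgebraicFunOn_aeval_div_aeval hσ (-X 1) q hq0).congr fun p _ => by
      simp [hJ, hqe, neg_div]
  · exact (isSemialgebraicFunOn_aeval_div_aeval hσ (X 2) q hq0).congr fun p _ => by
      simp [hJ, hqe]

/-- `|J p|² = 1 / |p|²` for `p ≠ 0`. [folklore] -/
theorem inversion_normSq_apply (J : (Fin 3 → ℝ) → (Fin 3 → ℝ))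
    (hJ : ∀ p, J p = ![p 0 / (p 0 ^ 2 + p 1 ^ 2 + p 2 ^ 2), -p 1 / (p 0 ^ 2 + p 1 ^ 2 + p 2 ^ 2),
      p 2 / (p 0 ^ 2 + p 1 ^ 2 + p 2 ^ 2)])
    {p : Fin 3 → ℝ} (hp : p 0 ^ 2 + p 1 ^ 2 + p 2 ^ 2 ≠ 0) :
    J p 0 ^ 2 + J p 1 ^ 2 + J p 2 ^ 2 = (p 0 ^ 2 + p 1 ^ 2 + p 2 ^ 2)⁻¹ := by
  simp only [hJ, Matrix.cons_val_zero, Matrix.cons_val_one, Matrix.head_cons, Matrix.cons_val_two,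
    Matrix.tail_cons]
  field_simp

/-- `J` is an involution off the origin: `J (J p) = p` for `p ≠ 0`. [cite: BenedettiPetronio1992, A.3.5] -/
theorem inversion_inversion (J : (Fin 3 → ℝ) → (Fin 3 → ℝ))
    (hJ : ∀ p, J p = ![p 0 / (p 0 ^ 2 + p 1 ^ 2 + p 2 ^ 2), -p 1 / (p 0 ^ 2 + p 1 ^ 2 + p 2 ^ 2),
      p 2 / (p 0 ^ 2 + p 1 ^ 2 + p 2 ^ 2)])
    {p : Fin 3 → ℝ} (hp : p 0 ^ 2 + p 1 ^ 2 + p 2 ^ 2 ≠ 0) : J (J p) = p := by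
  have hn := inversion_normSq_apply J hJ hp
  rw [hJ (J p), hn]
  simp only [hJ, Matrix.cons_val_zero, Matrix.cons_val_one, Matrix.head_cons, Matrix.cons_val_two,
    Matrix.tail_cons]
  funext i
  fin_cases i <;> simp <;> field_simp

/-- `J` is injective on any subset of the open upper half-space. [folklore] -/
theorem inversion_injOn (J : (Fin 3 → ℝ) → (Fin 3 → ℝ))
    (hJ : ∀ p, J p = ![p 0 / (p 0 ^ 2 + p 1 ^ 2 + p 2 ^ 2), -p 1 / (p 0 ^ 2 + p 1 ^ 2 + p 2 ^ 2),
      p 2 / (p 0 ^ 2 + p 1 ^ 2 + p 2 ^ 2)])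
    {σ : Set (Fin 3 → ℝ)} (hpos : σ ⊆ {p | 0 < p 2}) : InjOn J σ := by
  intro p hp q hq hpq
  have hp' := (inversion_normSq_pos (hpos hp)).ne'
  have hq' := (inversion_normSq_pos (hpos hq)).ne'
  rw [← inversion_inversion J hJ hp', ← inversion_inversion J hJ hq', hpq]

/-- `J` maps subsets of `{t > 0}` into `{t > 0}` (`(J p)₂ = t / |p|²`). [folklore] -/
theorem inversion_mapsTo (J : (Fin 3 → ℝ) → (Fin 3 → ℝ))
    (hJ : ∀ p, J p = ![p 0 / (p 0 ^ 2 + p 1 ^ 2 + p 2 ^ 2), -p 1 / (p 0 ^ 2 + p 1 ^ 2 + p 2 ^ 2),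
      p 2 / (p 0 ^ 2 + p 1 ^ 2 + p 2 ^ 2)])
    {σ : Set (Fin 3 → ℝ)} (hpos : σ ⊆ {p | 0 < p 2}) : MapsTo J σ {p | 0 < p 2} := by
  intro p hp
  have hp2 : 0 < p 2 := hpos hp
  show 0 < J p 2
  simp only [hJ, Matrix.cons_val_two, Matrix.tail_cons, Matrix.head_cons]
  exact div_pos hp2 (inversion_normSq_pos hp2)

/-- The squared norm `x ↦ x₀² + x₁² + x₂²` has Fréchet derivative `v ↦ 2 Σ pₖ vₖ` at `p`. [folklore] -/
theorem inversion_hasFDerivAt_normSq (p : Fin 3 → ℝ) :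
    HasFDerivAt (fun x : Fin 3 → ℝ => x 0 ^ 2 + x 1 ^ 2 + x 2 ^ 2)
      ((p 0 • ContinuousLinearMap.proj (R := ℝ) (φ := fun _ : Fin 3 => ℝ) 0 +
          p 0 • ContinuousLinearMap.proj (R := ℝ) (φ := fun _ : Fin 3 => ℝ) 0) +
        (p 1 • ContinuousLinearMap.proj (R := ℝ) (φ := fun _ : Fin 3 => ℝ) 1 +
          p 1 • ContinuousLinearMap.proj (R := ℝ) (φ := fun _ : Fin 3 => ℝ) 1) +
        (p 2 • ContinuousLinearMap.proj (R := ℝ) (φ := fun _ : Fin 3 => ℝ) 2 +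
          p 2 • ContinuousLinearMap.proj (R := ℝ) (φ := fun _ : Fin 3 => ℝ) 2)) p := by
  have h : ∀ k : Fin 3, HasFDerivAt (fun x : Fin 3 → ℝ => x k ^ 2)
      (p k • ContinuousLinearMap.proj (R := ℝ) (φ := fun _ : Fin 3 => ℝ) k +
        p k • ContinuousLinearMap.proj (R := ℝ) (φ := fun _ : Fin 3 => ℝ) k) p := fun k => by
    have := (hasFDerivAt_apply (𝕜 := ℝ) k p).fun_mul (hasFDerivAt_apply (𝕜 := ℝ) k p)
    simpa [sq] using this
  exact ((h 0).add (h 1)).add (h 2)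

/-- **The derivative of `J` and its determinant.** At `p ≠ 0`, `J` has the Fréchet derivative `L` of matrix
`M(p)ᵢⱼ = (sᵢ δᵢⱼ |p|² − 2 sᵢ pᵢ pⱼ)/|p|⁴` (`s = (1, −1, 1)`), and `det L = |p|⁻⁶`.
[cite: BenedettiPetronio1992, A.3.5] -/
theorem inversion_hasFDerivAt_det (J : (Fin 3 → ℝ) → (Fin 3 → ℝ))
    (hJ : ∀ p, J p = ![p 0 / (p 0 ^ 2 + p 1 ^ 2 + p 2 ^ 2), -p 1 / (p 0 ^ 2 + p 1 ^ 2 + p 2 ^ 2),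
      p 2 / (p 0 ^ 2 + p 1 ^ 2 + p 2 ^ 2)])
    {p : Fin 3 → ℝ} (hp : p 0 ^ 2 + p 1 ^ 2 + p 2 ^ 2 ≠ 0) :
    ∃ L : (Fin 3 → ℝ) →L[ℝ] (Fin 3 → ℝ), HasFDerivAt J L p ∧
      L.det = ((p 0 ^ 2 + p 1 ^ 2 + p 2 ^ 2) ^ 3)⁻¹ := by
  set n : ℝ := p 0 ^ 2 + p 1 ^ 2 + p 2 ^ 2 with hn
  set M : Matrix (Fin 3) (Fin 3) ℝ :=
    !![(n - 2 * p 0 ^ 2) / n ^ 2, -(2 * p 0 * p 1) / n ^ 2, -(2 * p 0 * p 2) / n ^ 2;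
       (2 * p 1 * p 0) / n ^ 2, -(n - 2 * p 1 ^ 2) / n ^ 2, (2 * p 1 * p 2) / n ^ 2;
       -(2 * p 2 * p 0) / n ^ 2, -(2 * p 2 * p 1) / n ^ 2, (n - 2 * p 2 ^ 2) / n ^ 2] with hM
  refine ⟨LinearMap.toContinuousLinearMap (Matrix.toLin' M), ?_, ?_⟩
  · -- derivative, componentwise: `J x i = s i * x i * |x|⁻²`
    have hnf := inversion_hasFDerivAt_normSq p
    have hinv := (hasDerivAt_inv hp).comp_hasFDerivAt p hnf
    have h0 : HasFDerivAt (fun x => J x 0)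
        ((ContinuousLinearMap.proj 0).comp (LinearMap.toContinuousLinearMap (Matrix.toLin' M))) p := by
      have hf : (fun x => J x 0) = fun x : Fin 3 → ℝ => x 0 * (x 0 ^ 2 + x 1 ^ 2 + x 2 ^ 2)⁻¹ := by
        funext x
        simp only [hJ, Matrix.cons_val_zero, div_eq_mul_inv]
      rw [hf]
      refine ((hasFDerivAt_apply (𝕜 := ℝ) (0 : Fin 3) p).fun_mul hinv).congr_fderiv ?_
      ext v
      simp [hM, Matrix.toLin'_apply, dotProduct, Fin.sum_univ_three, ← hn]
      field_simp
      ring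
    have h1 : HasFDerivAt (fun x => J x 1)
        ((ContinuousLinearMap.proj 1).comp (LinearMap.toContinuousLinearMap (Matrix.toLin' M))) p := by
      have hf : (fun x => J x 1) = fun x : Fin 3 → ℝ => -(x 1 * (x 0 ^ 2 + x 1 ^ 2 + x 2 ^ 2)⁻¹) := by
        funext x
        simp only [hJ, Matrix.cons_val_one, Matrix.cons_val_zero, div_eq_mul_inv, neg_mul]
      rw [hf]
      refine ((hasFDerivAt_apply (𝕜 := ℝ) (1 : Fin 3) p).fun_mul hinv).neg.congr_fderiv ?_
      ext v
      simp [hM, Matrix.toLin'_apply, dotProduct, Fin.sum_univ_three, ← hn]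
      field_simp
      ring
    have h2 : HasFDerivAt (fun x => J x 2)
        ((ContinuousLinearMap.proj 2).comp (LinearMap.toContinuousLinearMap (Matrix.toLin' M))) p := by
      have hf : (fun x => J x 2) = fun x : Fin 3 → ℝ => x 2 * (x 0 ^ 2 + x 1 ^ 2 + x 2 ^ 2)⁻¹ := by
        funext x
        simp only [hJ, Matrix.cons_val_two, Matrix.tail_cons, Matrix.head_cons, div_eq_mul_inv]
      rw [hf]
      refine ((hasFDerivAt_apply (𝕜 := ℝ) (2 : Fin 3) p).fun_mul hinv).congr_fderiv ?_
      ext v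
      simp [hM, Matrix.toLin'_apply, dotProduct, Fin.sum_univ_three, ← hn]
      field_simp
      ring
    refine hasFDerivAt_pi'' fun i => ?_
    fin_cases i
    exacts [h0, h1, h2]
  · -- determinant: `det M = n³ / n⁶` using `n = p₀² + p₁² + p₂²`
    rw [LinearMap.det_toContinuousLinearMap, LinearMap.det_toLin', Matrix.det_fin_three]
    simp [hM]
    field_simp
    rw [hn]
    ring

/-- **Inversion move data** (stub `stub_inversionMove` of line `bruhat-inversion-chain`). The unit inversion
composed with the mirror, `J(p) = (p₀, −p₁, p₂)/(p₀² + p₁² + p₂²)` (Poincaré extension of `w ↦ 1/w`), is, on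
every `ℚ`-semialgebraic `σ ⊆ {t > 0}`, a `ℚ`-semialgebraic injective map into `{t > 0}` with a derivative
of determinant `|p|⁻⁶` in absolute value, so that `t⁻³ = (J p)₃⁻³ · |det DJ|`.
[cite: BenedettiPetronio1992, A.3.5] -/
theorem stub_inversionMove : ∀ (J : (Fin 3 → ℝ) → (Fin 3 → ℝ)), (∀ p, J p = ![p 0 / (p 0 ^ 2 + p 1 ^ 2 + p 2 ^ 2), -p 1 / (p 0 ^ 2 + p 1 ^ 2 + p 2 ^ 2), p 2 / (p 0 ^ 2 + p 1 ^ 2 + p 2 ^ 2)]) → ∀ (σ : Set (Fin 3 → ℝ)), Literature.ModelTheory.ExponentialFields.IsSemialgebraic ℚ σ → σ ⊆ {p | 0 < p 2} → Literature.NumberTheory.Transcendental.IsSemialgebraicMapOn ℚ σ J ∧ Set.InjOn J σ ∧ Set.MapsTo J σ {p | 0 < p 2} ∧ ∃ J' : (Fin 3 → ℝ) → ((Fin 3 → ℝ) →L[ℝ] (Fin 3 → ℝ)), ∀ x ∈ σ, HasFDerivWithinAt J (J' x) σ x ∧ 1 / x 2 ^ 3 = 1 / (J x) 2 ^ 3 *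 |(J' x).det| := by
  intro J hJ σ hσ hpos
  refine ⟨inversion_isSemialgebraicMapOn J hJ hσ hpos, inversion_injOn J hJ hpos, inversion_mapsTo J hJ hpos,
    ?_⟩
  -- a derivative at every point off the origin (chosen arbitrarily elsewhere)
  have hex : ∀ x : Fin 3 → ℝ, ∃ L : (Fin 3 → ℝ) →L[ℝ] (Fin 3 → ℝ),
      x 0 ^ 2 + x 1 ^ 2 + x 2 ^ 2 ≠ 0 → HasFDerivAt J L x ∧ L.det = ((x 0 ^ 2 + x 1 ^ 2 + x 2 ^ 2) ^ 3)⁻¹ := by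
    intro x
    by_cases hx : x 0 ^ 2 + x 1 ^ 2 + x 2 ^ 2 = 0
    · exact ⟨0, fun h => (h hx).elim⟩
    · obtain ⟨L, hL, hdet⟩ := inversion_hasFDerivAt_det J hJ hx
      exact ⟨L, fun _ => ⟨hL, hdet⟩⟩
  choose J' hJ' using hex
  refine ⟨J', fun x hx => ?_⟩
  have hx2 : 0 < x 2 := hpos hx
  have hn : 0 < x 0 ^ 2 + x 1 ^ 2 + x 2 ^ 2 := inversion_normSq_pos hx2
  obtain ⟨hL, hdet⟩ := hJ' x hn.ne'
  refine ⟨hL.hasFDerivWithinAt, ?_⟩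
  have hJ2 : J x 2 = x 2 / (x 0 ^ 2 + x 1 ^ 2 + x 2 ^ 2) := by
    simp only [hJ, Matrix.cons_val_two, Matrix.tail_cons, Matrix.head_cons]
  rw [hdet, hJ2, abs_of_pos (inv_pos.mpr (pow_pos hn 3))]
  field_simp

end Summit.KontsevichZagierPeriods.HyperbolicBloch.IsometryMove

end
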